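import Summits.ResolutionOfSingularities.ResolutionOfSingularities.Theorems.EquisingularLiftEquisingularLiftNatCarrierDeltaHDeltaTC
import HarnessLib

/-!
# [OURS · L1 W4.5(b) · EL♮(3)] HSUB(ReachTC⁺) brick `inv_base`, part 1a: LEMMAS for the uncentred member — regular exceptional divisor,
# principal cone stalks, and T-CARRIER-Δ for an ARBITRARY cone ideal sheaf with the prescribed germ

Crux chain w45b (cell `res-hironaka`, slot W4.5(b)), working crux **EL♮** = stmt-ResolutionOfSingularities-20038, child **EL♮(3)** =
stmt-ResolutionOfSingularities-20148, route EquisingularLift, line `sections`, registered stub `stub_elnat_tcPlusPointResolution`;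
assembly HSUB(ReachTC⁺)₃ of res-L1-w45b-stub-1 (driver `hsub_reachTCPlus_of_invariant`, p526242; brick `inv_base` dealt to
res-type-100 2026-08-27T11:31:42Z). HONEST FRAMING: OURS; NOT a statement of any manuscript; AI-written, weaker than expert review.
No `sorry`; standard axioms. Filed `--supports stmt-ResolutionOfSingularities-20148 --as helper`. DEF-FREE (the predicates `Member` /
`Inv` of res-L1-w45b-stub-1's …SubchainSupplierInvDefs are spelled out clause by clause; the thin wrapper `inv_base` packages them).

WHAT (all folklore bookkeeping around res-type-100's T-CARRIER-Δ kit p509910/p512232/p513634/p520673).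
* `isRegularLocalRing_quotient_stalkIdeal_of_isRegular_subscheme` — `V(C)` regular ⇒ `𝒪_{X,z}/C_z` regular at its points.
* `isRegularLocalRing_stalk_quotient_exceptional` — at a point `x'` of a blow-up `τ` along `J` over `p ∈ supp J`, with `J_p = (c)`,
  `c` quasi-regular and `𝒪_{X,p}/(c)` a regular ring: `𝒪_{X',x'}/E_{x'}` is a regular local ring (`E = J·𝒪_{X'}`; the chart
  quotient `R[I/c_j]/(c_j) ≅ (R/(c))[T_l : l ≠ j]`, tree `blowupAlgebraQuotEquiv`, is a regular ring).
* `isRegular_exceptional_subscheme` — for a section `s` of a proper `q : P → Spec O` (`O` a DVR) through a regular point and a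
  blow-up `τ : X₁ → P` along `ker s`: the exceptional divisor `V((ker s)·𝒪_{X₁})` is a REGULAR scheme.
* `isPrincipal_stalkIdeal_strictTransformIdeal_of_cone` — F2 at a named point: `St_τ(K)` is principal at the points over the vertex.
* `eval_ne_zero_of_isQuasiRegular` — the cone germ `Φ(c)` is non-zero.
* `carrierDelta_clauses_of_stalk` — T-CARRIER-Δ in one theorem (`carrierDelta_clauses_of_coneForm'`) for an ARBITRARY ideal sheaf
  `K₀` with `K₀_p = (ι_* Φ₀ (c))` (so that `K₀` may be chosen stalkwise principal on all of `P`, e.g. a Cartier divisor with that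
  germ): `V(St K₀ ⊔ E)` regular, flat over `O`, inside `E`.
Consumed by part 1b (`exists_coneGerm_of_admTC`, the uncentred member of `inv_base`) and by the centred members.
References (index only): res-L1-w45b-stub-1 SubchainSupplierInvDefs.lean v3 / HSUB-TCPLUS3-skeleton.lean (OURS planning texts).
-/

set_option linter.dupNamespace false -- mandated namespace `Summit.<Summit>.<Problem>` of this single-conjunct summit
set_option linter.overlappingInstances false -- the binders carry `[IsDomain O] [IsDiscreteValuationRing O]`

noncomputable section

open CategoryTheory CategoryTheory.Limits AlgebraicGeometry TopologicalSpace IsLocalRing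
open Literature.AlgebraicGeometry.Resolution
open AlgebraicGeometry.Scheme.IdealSheafData
open Summit.ResolutionOfSingularities.ResolutionOfSingularities.Cruxes.EquisingularLift.StrataSplit

namespace Summit.ResolutionOfSingularities.ResolutionOfSingularities.Cruxes.EquisingularLiftNat.Sections

universe u

/-! ## The exceptional divisor of the blow-up of a regular centre with regular quotient is regular -/

section Exceptional

variable {X X' : Scheme.{u}} {τ : X' ⟶ X} {J : X.IdealSheafData}

/-- A closed subscheme `V(C)` of a regular scheme has regular quotient stalks `𝒪_{X,z}/C_z` at its points when it is regular
(tree `isRegularLocalRing_stalk_subscheme_iff`). [folklore] -/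
theorem isRegularLocalRing_quotient_stalkIdeal_of_isRegular_subscheme (C : X.IdealSheafData)
    (hreg : Scheme.IsRegular C.subscheme) {z : X} (hz : z ∈ C.support) :
    IsRegularLocalRing (X.presheaf.stalk z ⧸ stalkIdeal C z) := by
  -- adapted from `isRegularLocalRing_quotient_of_isRegular_subscheme` (…WeightedInvariantLocalWeightedDropTrackCStep)
  have hz' : z ∈ Set.range C.subschemeι := by rw [Scheme.IdealSheafData.range_subschemeι]; exact hz
  obtain ⟨s, hs⟩ := hz'
  subst hs
  exact (isRegularLocalRing_stalk_subscheme_iff C s).mp (hreg s)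

/-- Localisation commutes with quotients, regular-ring form: for an abstract localisation `S` of `B` at a prime `𝔔 ⊇ 𝔞` with
`B/𝔞` a regular ring, `S/𝔞S` is a regular local ring. [folklore] -/
theorem isRegularLocalRing_quotient_map_of_isRegularRing_quotient {B S : Type*} [CommRing B] [CommRing S] [Algebra B S]
    (𝔔 : Ideal B) [𝔔.IsPrime] [IsLocalization.AtPrime S 𝔔] (𝔞 : Ideal B) (h𝔞𝔔 : 𝔞 ≤ 𝔔) [IsRegularRing (B ⧸ 𝔞)] :
    IsRegularLocalRing (S ⧸ 𝔞.map (algebraMap B S)) := by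
  haveI hprime : (𝔔.map (Ideal.Quotient.mk 𝔞)).IsPrime :=
    Ideal.map_isPrime_of_surjective Ideal.Quotient.mk_surjective (by rw [Ideal.mk_ker]; exact h𝔞𝔔)
  have hreg : IsRegularLocalRing (Localization.AtPrime (𝔔.map (Ideal.Quotient.mk 𝔞))) :=
    IsRegularRing.isRegularLocalRing_localization _
  exact isRegularLocalRing_quotient_map_of_isLocalization 𝔔 𝔞 h𝔞𝔔 hreg

set_option maxHeartbeats 400000 in -- the chart algebra `blowupAlgebra` is a subalgebra of a localisation: slow instance unification (cf. p509910)
/-- **The quotient stalks by the exceptional ideal are regular.** `τ : X' → X` a blow-up along `J`, `X'` locally Noetherian,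
`τ x' = p ∈ supp J`, `J_p = (c)` with `c` quasi-regular and `𝒪_{X,p}/(c)` a regular ring (e.g. `≅ O` a DVR). Then
`𝒪_{X',x'}/E_{x'}` is a regular local ring, `E = J·𝒪_{X'}`: in res-L1-w45b-stub-2's presentation `𝒪_{X',x'} ≅ R[I/c_j]_𝔔`,
`E_{x'} = (c_j/1)` and `R[I/c_j]/(c_j/1) ≅ (R/(c))[T_l : l ≠ j]` (tree `blowupAlgebraQuotEquiv`) is a regular ring.
[cite: Liu2002, Thm. 8.1.19 (a); StacksProject, Tag 0BIQ] -/
theorem isRegularLocalRing_stalk_quotient_exceptional [IsLocallyNoetherian X'] (hτ : IsBlowup τ J) (x' : X') (p : X)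
    (hp : τ x' = p) (hpJ : p ∈ (J.support : Set X)) {r : ℕ} (c : Fin r → X.presheaf.stalk p)
    (hcJ : Ideal.span (Set.range c) = stalkIdeal J p) (hc : IsQuasiRegular c)
    [IsRegularRing (X.presheaf.stalk p ⧸ Ideal.span (Set.range c))] :
    IsRegularLocalRing (X'.presheaf.stalk x' ⧸ stalkIdeal (J.comap τ) x') := by
  subst hp
  obtain ⟨j, 𝔔, χ, e, hχ, he, h𝔔⟩ :=
    exists_blowupAlgebra_stalk_ringEquiv_of_eq hτ x' c (Ideal.span (Set.range c)) rfl hcJ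
  letI := χ.toAlgebra
  haveI : IsLocalization.AtPrime (X'.presheaf.stalk x') 𝔔.asIdeal := isLocalization_stalk_of_ringEquiv 𝔔 x' χ e he
  have hstalkMap : (τ.stalkMap x').hom = χ.comp (algebraMap _ (blowupAlgebra (Ideal.span (Set.range c)) (c j))) :=
    RingHom.ext fun a => (hχ a).symm
  -- `E_{x'} = (c_j/1)·𝒪_{X',x'}`
  have hE : stalkIdeal (J.comap τ) x' =
      (Ideal.span {algebraMap _ (blowupAlgebra (Ideal.span (Set.range c)) (c j)) (c j)}).map
        (algebraMap (blowupAlgebra (Ideal.span (Set.range c)) (c j)) (X'.presheaf.stalk x')) := by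
    rw [stalkIdeal_comap_eq_map_stalkMap, ← hcJ, hstalkMap, ← Ideal.map_map,
      map_blowupAlgebra_eq_span (Ideal.subset_span (Set.mem_range_self j))]
    rfl
  -- `(c_j/1) ⊆ 𝔔` over `supp J`
  have ht𝔔 : algebraMap _ (blowupAlgebra (Ideal.span (Set.range c)) (c j)) (c j) ∈ 𝔔.asIdeal := by
    rw [← Ideal.mem_comap, h𝔔]
    have h := (mem_support_iff_stalkIdeal_le J (τ x')).mp hpJ
    rw [← hcJ] at h
    exact h (Ideal.subset_span (Set.mem_range_self j))
  have h𝔞𝔔 : Ideal.span {algebraMap _ (blowupAlgebra (Ideal.span (Set.range c)) (c j)) (c j)} ≤ 𝔔.asIdeal :=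
    (Ideal.span_singleton_le_iff_mem _).mpr ht𝔔
  -- the chart quotient is a polynomial ring over the regular ring `R/(c)`
  haveI hRR : IsRegularRing (blowupAlgebra (Ideal.span (Set.range c)) (c j) ⧸
      Ideal.span {algebraMap _ (blowupAlgebra (Ideal.span (Set.range c)) (c j)) (c j)}) :=
    IsRegularRing.of_ringEquiv (blowupAlgebraQuotEquiv c j hc)
  have hS := isRegularLocalRing_quotient_map_of_isRegularRing_quotient (S := X'.presheaf.stalk x') 𝔔.asIdeal _ h𝔞𝔔
  rw [← hE] at hS
  exact hS

end Exceptional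

section ExceptionalSection

variable (O : Type) [CommRing O] [IsDomain O] [IsDiscreteValuationRing O]

/-- **The exceptional divisor of the blow-up of a section is a regular scheme.** `O` a DVR, `q : P → Spec O` proper, `s` a
section with `𝒪_{P,s(s₀)}` regular, `τ : X₁ → P` a blow-up along `ker s` (`X₁` locally Noetherian), `(ker s)_{s(s₀)} = (c)` with
`c` quasi-regular and `𝒪_{P,s(s₀)}/(c) ≅ O` (data at a named point `p = s(s₀)`): then `V((ker s)·𝒪_{X₁})` is regular — at its special points (all over `s(s₀)`) by
`isRegularLocalRing_stalk_quotient_exceptional`, everywhere by res-type-032's `Scheme.isRegular_subscheme_of_forall_over_closedPoint`.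
[cite: Liu2002, Thm. 8.1.19 (a)] -/
theorem isRegular_exceptional_subscheme {P X₁ : Scheme.{0}} [IsLocallyNoetherian P] (q : P ⟶ Spec (.of O))
    [IsProper q] (s : Spec (.of O) ⟶ P) (hs : s ≫ q = 𝟙 _) (p : P) (hp : s (IsLocalRing.closedPoint O) = p)
    (τ : X₁ ⟶ P) (hτ : IsBlowup τ s.ker)
    [IsLocallyNoetherian X₁] {r : ℕ} (c : Fin r → P.presheaf.stalk p)
    (hcJ : Ideal.span (Set.range c) = stalkIdeal s.ker p) (hc : IsQuasiRegular c)
    (θ : (P.presheaf.stalk p ⧸ Ideal.span (Set.range c)) ≃+* O) :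
    Scheme.IsRegular (s.ker.comap τ).subscheme := by
  subst hp
  haveI : IsSeparated q := inferInstance
  haveI : IsProper τ := hτ.isProper
  haveI : UniversallyClosed ((s.ker.comap τ).subschemeι ≫ τ ≫ q) := inferInstance
  haveI : IsRegularRing (P.presheaf.stalk (s (IsLocalRing.closedPoint O)) ⧸ Ideal.span (Set.range c)) :=
    IsRegularRing.of_ringEquiv θ.symm
  obtain ⟨-, -, -, hsupp⟩ := section_isClosedImmersion_and_isRegular_ker O P q s hs
  have hcomp : ∀ t', q (s t') = t' := fun t' => by rw [← Scheme.Hom.comp_apply, hs]; rfl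
  refine Scheme.isRegular_subscheme_of_forall_over_closedPoint (τ ≫ q) _ fun x' hx'E hq => ?_
  -- the point lies over `s(s₀)`
  have hx' : τ x' ∈ (s.ker.support : Set P) := by
    rw [Scheme.IdealSheafData.support_comap] at hx'E
    exact hx'E
  have hx's : τ x' ∈ Set.range s := by rw [← hsupp]; exact hx'
  obtain ⟨t', ht'⟩ := hx's
  have hq' : q (τ x') = IsLocalRing.closedPoint O := by rw [← Scheme.Hom.comp_apply]; exact hq
  have htt : t' = IsLocalRing.closedPoint O := by rw [← hcomp t', ht']; exact hq'
  rw [htt] at ht'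
  rw [← ht'] at hx'
  exact isRegularLocalRing_stalk_quotient_exceptional hτ x' _ ht'.symm hx' c hcJ hc

end ExceptionalSection

section Principal

variable {X X' : Scheme.{u}} {τ : X' ⟶ X} {J : X.IdealSheafData}

/-- **The strict transform of the cone is principal at the points over the vertex** (F2 `exists_stalk_strictTransformIdeal_sup_comap`,
p509910, with the cone data at a named point `p = τ x'`): `St_τ(K)_{x'} = (χ Φ(c/c_j))`. [cite: StacksProject, Tag 0804] -/
theorem isPrincipal_stalkIdeal_strictTransformIdeal_of_cone [IsLocallyNoetherian X'] (hτ : IsBlowup τ J)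
    (K : X.IdealSheafData) (x' : X') (p : X) (hp : τ x' = p) (hpJ : p ∈ (J.support : Set X)) {r : ℕ}
    (c : Fin r → X.presheaf.stalk p) (hcJ : Ideal.span (Set.range c) = stalkIdeal J p)
    (hc : IsQuasiRegular c) [IsDomain (X.presheaf.stalk p ⧸ Ideal.span (Set.range c))]
    {d : ℕ} (Φ : MvPolynomial (Fin r) (X.presheaf.stalk p)) (hΦd : Φ.IsHomogeneous d)
    (hΦ : MvPolynomial.map (Ideal.Quotient.mk (Ideal.span (Set.range c))) Φ ≠ 0)
    (hK : stalkIdeal K p = Ideal.span {MvPolynomial.eval c Φ}) :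
    (stalkIdeal (strictTransformIdeal τ J K) x').IsPrincipal := by
  subst hp
  obtain ⟨j, 𝔔, χ, e, -, -, -, -, hSt, -, -⟩ := exists_stalk_strictTransformIdeal_sup_comap hτ K x' hpJ c hcJ hc Φ hΦd hΦ hK
  exact ⟨⟨_, hSt⟩⟩

end Principal

/-! ## The cone germ is non-zero; T-CARRIER-Δ one-theorem form for an ARBITRARY ideal sheaf with the cone stalk -/

section ConeStalk

/-- A form `Φ` of degree `d` in a quasi-regular sequence `c` with `Φ mod (c) ≠ 0` has `Φ(c) ≠ 0` (`Φ(c) = 0 ∈ (c)^{d+1}` would put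
every coefficient of `Φ` in `(c)`). [cite: Matsumura1987, §16 Definition p. 124] -/
theorem eval_ne_zero_of_isQuasiRegular {R : Type u} [CommRing R] {r : ℕ} {c : Fin r → R} (hc : IsQuasiRegular c) {d : ℕ}
    {Φ : MvPolynomial (Fin r) R} (hΦd : Φ.IsHomogeneous d)
    (hΦ : MvPolynomial.map (Ideal.Quotient.mk (Ideal.span (Set.range c))) Φ ≠ 0) :
    MvPolynomial.eval c Φ ≠ 0 := by
  intro h0
  apply hΦ
  refine map_eq_zero_of_coeff_mem_ker _ fun m => ?_
  rw [Ideal.mk_ker]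
  exact (isQuasiRegular_def c).mp hc d Φ hΦd (by rw [h0]; exact Submodule.zero_mem _) m

variable (O : Type) [CommRing O] [IsDomain O] [IsDiscreteValuationRing O]

/-- **T-CARRIER-Δ IN ONE THEOREM FOR AN ARBITRARY CONE IDEAL SHEAF** (res-type-100's `carrierDelta_clauses_of_coneForm'`, p520673,
with the cone ideal `K₀` a PARAMETER subject only to `K₀_p = (Φ₀(c))` — e.g. a Cartier divisor with that germ — instead of the kernel
ideal of `Spec (𝒪_{P,p}/(Φ₀(c))) → P`). INPUT: `O` a DVR with uniformizer `ϖ`, `q : P → Spec O` proper, a section `s` with `s(s₀) = p`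
regular, a blow-up `τ : X₁ → P` along `ker s`, coordinates `c` of the section at `p` (`(c) = (ker s)_p`, `dim 𝒪_{P,p} = n + 1`), a form
`Φ₀ ∈ O[T₁..T_n]` of degree `d` with `Φ₀ mod 𝔪_O ≠ 0`, the Δ-criterion in res-type-032's `_comp` currency, and `K₀` with
`K₀_p = (ι_* Φ₀ (c))`. OUTPUT for `C := St_τ(K₀) ⊔ (ker s)·𝒪_{X₁}`: `V(C)` regular, `V(C) → Spec O` flat, `supp C ⊆ supp E`.
[cite: Hartshorne1977, III Prop. 9.7; Liu2002, Thm. 8.1.19] -/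
theorem carrierDelta_clauses_of_stalk {P X₁ : Scheme.{0}} [IsLocallyNoetherian P] (q : P ⟶ Spec (.of O))
    [IsProper q] (s : Spec (.of O) ⟶ P) (hs : s ≫ q = 𝟙 _) (p : P) (hp : s (IsLocalRing.closedPoint O) = p)
    (hreg : IsRegularLocalRing (P.presheaf.stalk p))
    (τ : X₁ ⟶ P) (hτ : IsBlowup τ s.ker) (ϖ : O) (hϖ : Irreducible ϖ) {n : ℕ}
    (c : Fin n → P.presheaf.stalk p)
    (hcI : Ideal.span (Set.range c) = stalkIdeal s.ker p)
    (hdim : ringKrullDim (P.presheaf.stalk p) = (n + 1 : ℕ))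
    {d : ℕ} (Φ₀ : MvPolynomial (Fin n) O) (hΦ₀d : Φ₀.IsHomogeneous d)
    (hΦ₀ : MvPolynomial.map (IsLocalRing.residue O) Φ₀ ≠ 0)
    (hΔ : ∀ (ρ : P.presheaf.stalk p →+* O),
      ρ.comp ((Scheme.ΓSpecIso (.of O)).inv ≫ q.appTop ≫ P.presheaf.Γgerm p).hom =
        RingHom.id O →
      ∀ (j : Fin n) (Q : Ideal (MvPolynomial {l : Fin n // l ≠ j} O ⧸ Ideal.span {MvPolynomial.map ρ
        (dehomogenize j (MvPolynomial.map
          ((Scheme.ΓSpecIso (.of O)).inv ≫ q.appTop ≫ P.presheaf.Γgerm p).hom Φ₀))}))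
        [Q.IsPrime],
        Ideal.Quotient.mk _ (MvPolynomial.C ϖ : MvPolynomial {l : Fin n // l ≠ j} O) ∈ Q →
          IsRegularLocalRing (Localization.AtPrime Q))
    (K₀ : P.IdealSheafData)
    (hK : stalkIdeal K₀ p = Ideal.span {MvPolynomial.eval c (MvPolynomial.map
      ((Scheme.ΓSpecIso (.of O)).inv ≫ q.appTop ≫ P.presheaf.Γgerm p).hom Φ₀)}) :
    Scheme.IsRegular (strictTransformIdeal τ s.ker K₀ ⊔ s.ker.comap τ).subscheme ∧
      Flat ((strictTransformIdeal τ s.ker K₀ ⊔ s.ker.comap τ).subschemeι ≫ τ ≫ q) ∧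
      (((strictTransformIdeal τ s.ker K₀ ⊔ s.ker.comap τ).support : Set X₁) ⊆ ((s.ker.comap τ).support : Set X₁)) := by
  -- adapted from `carrierDelta_clauses_of_coneForm` (…NatCarrierDeltaOfConeForm, res-type-100): the same kit calls, `hK` a hypothesis
  subst hp
  haveI : IsProper τ := hτ.isProper
  haveI : IsLocallyNoetherian X₁ := LocallyOfFiniteType.isLocallyNoetherian τ
  haveI := hreg
  obtain ⟨θ, hqr, hdom, hθ, h𝔪, hϖc⟩ := exists_sectionFrame_of_span_eq_forall O q s hs hreg ϖ hϖ c hcI hdim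
  haveI := hdom
  have hι : ∀ b : O, ((Scheme.ΓSpecIso (.of O)).inv ≫ q.appTop ≫ P.presheaf.Γgerm (s (IsLocalRing.closedPoint O))).hom b =
      (P.presheaf.Γgerm (s (IsLocalRing.closedPoint O))).hom (q.appTop.hom ((Scheme.ΓSpecIso (.of O)).inv.hom b)) :=
    fun b => rfl
  have hΦd : (MvPolynomial.map ((Scheme.ΓSpecIso (.of O)).inv ≫ q.appTop ≫
      P.presheaf.Γgerm (s (IsLocalRing.closedPoint O))).hom Φ₀).IsHomogeneous d := hΦ₀d.map _
  have hΦ𝔪 := map_residue_map_ne_zero O ((Scheme.ΓSpecIso (.of O)).inv ≫ q.appTop ≫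
      P.presheaf.Γgerm (s (IsLocalRing.closedPoint O))).hom hΦ₀
  have hI𝔪 : Ideal.span (Set.range c) ≤ maximalIdeal _ := h𝔪 ▸ le_sup_left
  have hΦ := map_mk_ne_zero_of_map_residue_ne_zero hI𝔪 hΦ𝔪
  have hϖ𝔪 : (P.presheaf.Γgerm (s (IsLocalRing.closedPoint O))).hom (q.appTop.hom ((Scheme.ΓSpecIso (.of O)).inv.hom ϖ)) ∈
      maximalIdeal _ := h𝔪 ▸ Ideal.mem_sup_right (Ideal.mem_span_singleton_self _)
  have hρι : (θ.toRingHom.comp (Ideal.Quotient.mk (Ideal.span (Set.range c)))).comp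
      ((Scheme.ΓSpecIso (.of O)).inv ≫ q.appTop ≫ P.presheaf.Γgerm (s (IsLocalRing.closedPoint O))).hom = RingHom.id O := by
    ext b
    simp only [RingHom.comp_apply, RingHom.id_apply, hι]
    exact hθ b
  have hregΔ := hΔ _ hρι
  refine ⟨?_, ?_, ?_⟩
  · refine isRegular_carrierDelta_subscheme O q s hs τ hτ K₀ c hcI hqr _ hΦd hΦ hK ϖ hϖ𝔪 θ fun j 𝔓 _ h𝔓 => ?_
    rw [hθ] at h𝔓
    exact hregΔ j 𝔓 h𝔓
  · exact flat_carrierDelta_subschemeι_comp O q s hs τ hτ K₀ c hcI hqr _ hΦd hK ϖ hϖ h𝔪 hϖc hΦ𝔪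
  · intro x hx
    have h := support_strictTransformIdeal_sup_comap_subset τ s.ker K₀ hx
    rwa [Scheme.IdealSheafData.support_comap, Closeds.coe_preimage]

end ConeStalk


end Summit.ResolutionOfSingularities.ResolutionOfSingularities.Cruxes.EquisingularLiftNat.Sections

end
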